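import Summits.BirchSwinnertonDyer.BirchSwinnertonDyer.Theorems.PublishedInputsGreenbergLemma34Devissage
import HarnessLib

set_option linter.dupNamespace false -- `…BirchSwinnertonDyer.BirchSwinnertonDyer…` is the cell's nested layout (D-0017)
set_option autoImplicit false

/-!
# Greenberg LNM 1716 Lemma 3.4, STRUCTURE of `ker(r_{v_n})`: the dévissage `0 → (M₁/D₁M₁)[p^∞] → (M/DM)[p^∞] → r(M)[p^∞]`
# as subgroup + injective quotient map (structural form of gen 5's `natCard_primaryComponent_quotient_eq_mul`)

Seat `bsd-inputs-k4-p1` (gen 6; LADDER-BSD D-0154 KEY (147)(f) «prove the printed input», row 1 K4 INPUTS; Greenberg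
1999), `--supports stmt-BirchSwinnertonDyer-20309`. THEOREMS ONLY (no definition, no named fact, no `sorry`).

Greenberg, LNM 1716 (1999), §3 proof of Lemma 3.4 (p. 89): `|ker(r_{v_n})| = |ker(a_{v_n})| · |ker(b_{v_n})|` with
`ker(a_{v_n}) ≅ Ẽ(f_{v_n})_p` a SUBGROUP of `ker(r_{v_n})` and `ker(b_{v_n}) ≅ ker(d_{v_n})` the quotient — the tree's named
fact `Greenberg1999.lemma34_localTowerKerPrimary_cyclicExtension_rat` records exactly this cyclic-by-cyclic structure. Gen 5's
dévissage (`natCard_primaryComponent_quotient_eq_mul`, points currency: `M` with endomorphism `D`, `r : M → T` with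
`r ∘ D = 0` and invariant lifts, `j : M₁ ↪ M` onto `ker r` with `j ∘ D₁ = D ∘ j`) exported only the COUNT. This file exports
the structure, with no finiteness and no coinvariant-vanishing hypothesis:

* `exists_addSubgroup_primaryComponent_quotient` — there is a subgroup `A ≤ (M/DM)[p^∞]` with
  `A ≃+ (M₁/D₁M₁)[p^∞]` (the image of the injective map `M₁/D₁M₁ → M/DM` induced by `j`) and an INJECTIVE homomorphism
  `(M/DM)[p^∞] ⧸ A →+ r(M)[p^∞]` (induced by `r̄ : M/DM → T`).

HONEST FRAMING: an algebra lemma; closes nothing; no summit statement is proved; BSD is not proved by any of this.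

References: [GreenbergLNM1716] §2 Prop. 2.5 (p. 80), §3 Lemma 3.4 (p. 89).
-/

noncomputable section

open scoped Classical

universe u v w

namespace Summit.BirchSwinnertonDyer.BirchSwinnertonDyer.Theorems.InputsGreenbergLemma34Layer

variable {M : Type u} {M₁ : Type v} {T : Type w} [AddCommGroup M] [AddCommGroup M₁] [AddCommGroup T]

set_option maxHeartbeats 800000 in
/-- **The dévissage of the `p`-primary coinvariants as a cyclic-extension candidate.** `M` an additive group with an
endomorphism `D`; `r : M → T` additive with `r ∘ D = 0` and invariant lifts (`hlift`); `j : M₁ ↪ M` onto `ker r` with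
`j ∘ D₁ = D ∘ j`. Then there is a subgroup `A` of `(M/DM)[p^∞]` — the `p`-power-torsion classes coming from `M₁` — with
`A ≃+ (M₁/D₁M₁)[p^∞]`, and the map induced by `r` is an INJECTIVE homomorphism `(M/DM)[p^∞] ⧸ A →+ r(M)[p^∞]`.
(Gen 5's `natCard_primaryComponent_quotient_eq_mul` is the count `#(M/DM)[p^∞] = #(M₁/D₁M₁)[p^∞] · #r(M)[p^∞]`, whose
surjectivity half needs the coinvariant vanishing; the structure does not.) [cite: GreenbergLNM1716, §3 Lemma 3.4 (p. 89)] -/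
theorem exists_addSubgroup_primaryComponent_quotient (p : ℕ)
    (D : M →+ M) (r : M →+ T) (hrD : ∀ x, r (D x) = 0)
    (hlift : ∀ x : M, ∃ x₀ : M, D x₀ = 0 ∧ r x₀ = r x)
    (j : M₁ →+ M) (hj : Function.Injective j) (hjr : ∀ x, r (j x) = 0) (hrj : ∀ y, r y = 0 → ∃ x, j x = y)
    (D₁ : M₁ →+ M₁) (hD₁ : ∀ x, j (D₁ x) = D (j x)) :
    ∃ A : AddSubgroup (AddCommGroup.primaryComponent (M ⧸ D.range) p),
      Nonempty (A ≃+ AddCommGroup.primaryComponent (M₁ ⧸ D₁.range) p) ∧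
      ∃ f : (↥(AddCommGroup.primaryComponent (M ⧸ D.range) p) ⧸ A) →+ AddCommGroup.primaryComponent r.range p,
        Function.Injective f := by
  -- adapted from Summits/.../Theorems/PublishedInputsGreenbergLemma34Devissage.lean (gen 5: the count)
  -- notation
  let Q := M ⧸ D.range
  let Q₁ := M₁ ⧸ D₁.range
  -- `r` descends to `r̄ : M/DM → T`
  have hle : D.range ≤ r.ker := by
    rintro _ ⟨x, rfl⟩
    exact (AddMonoidHom.mem_ker).mpr (hrD x)
  let rbar : Q →+ T := QuotientAddGroup.lift D.range r hle
  have hrbar : ∀ x : M, rbar (QuotientAddGroup.mk x) = r x := fun x ↦ QuotientAddGroup.lift_mk' _ _ x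
  -- the map `ι : M₁/D₁M₁ → M/DM` induced by `j`, injective by the invariant lifts
  have hle₁ : D₁.range ≤ D.range.comap j := by
    rintro _ ⟨x, rfl⟩
    exact ⟨j x, (hD₁ x).symm⟩
  let ι : Q₁ →+ Q := QuotientAddGroup.map D₁.range D.range j hle₁
  have hι : ∀ x : M₁, ι (QuotientAddGroup.mk x) = QuotientAddGroup.mk (j x) := fun x ↦
    QuotientAddGroup.map_mk' _ _ _ _ x
  have hιinj : Function.Injective ι := by
    refine (injective_iff_map_eq_zero ι).mpr fun c hc ↦ ?_
    obtain ⟨x, rfl⟩ := QuotientAddGroup.mk_surjective c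
    rw [hι, QuotientAddGroup.eq_zero_iff] at hc
    obtain ⟨y, hy⟩ := hc
    obtain ⟨y₀, hDy₀, hry₀⟩ := hlift y
    obtain ⟨y₁, hy₁⟩ := hrj (y - y₀) (by rw [map_sub, hry₀, sub_self])
    rw [QuotientAddGroup.eq_zero_iff]
    refine ⟨y₁, hj ?_⟩
    rw [hD₁, hy₁, map_sub, hDy₀, sub_zero, hy]
  -- the `p`-primary parts
  let P : AddSubgroup Q := AddCommGroup.primaryComponent Q p
  have hP : ∀ c : Q, c ∈ P ↔ ∃ k : ℕ, p ^ k • c = 0 := fun c ↦ AddCommGroup.mem_primaryComponent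
  let P₁ : AddSubgroup Q₁ := AddCommGroup.primaryComponent Q₁ p
  have hP₁ : ∀ c : Q₁, c ∈ P₁ ↔ ∃ k : ℕ, p ^ k • c = 0 := fun c ↦ AddCommGroup.mem_primaryComponent
  let Ar : AddSubgroup r.range := AddCommGroup.primaryComponent r.range p
  have hAr : ∀ c : r.range, c ∈ Ar ↔ ∃ k : ℕ, p ^ k • c = 0 := fun c ↦ AddCommGroup.mem_primaryComponent
  -- `φ = r̄|_P : P → T`
  let φ : P →+ T := rbar.comp P.subtype
  have hφ : ∀ c : P, φ c = rbar (c : Q) := fun _ ↦ rfl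
  -- (1) `ker φ ≃+ P₁`: every element of `ker φ` is the class of some `j x₁`
  have hker_mem : ∀ k : φ.ker, ∃ x : M₁, ι (QuotientAddGroup.mk x) = ((k : P) : Q) := by
    intro k
    obtain ⟨x, hx⟩ := QuotientAddGroup.mk_surjective ((k : P) : Q)
    have hk0 : φ k = 0 := k.2
    have hrx : r x = 0 := by
      rw [hφ, ← hx, hrbar] at hk0
      exact hk0
    obtain ⟨x₁, rfl⟩ := hrj x hrx
    exact ⟨x₁, by rw [hι, hx]⟩
  have hker_prim : ∀ k : φ.ker, (QuotientAddGroup.mk (hker_mem k).choose : Q₁) ∈ P₁ := by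
    intro k
    obtain ⟨n, hn⟩ := (hP _).mp (k : P).2
    refine (hP₁ _).mpr ⟨n, hιinj ?_⟩
    rw [map_nsmul, (hker_mem k).choose_spec, map_zero]
    exact hn
  let ψ : φ.ker → P₁ := fun k ↦ ⟨QuotientAddGroup.mk (hker_mem k).choose, hker_prim k⟩
  have hψι : ∀ k : φ.ker, ι ((ψ k : P₁) : Q₁) = ((k : P) : Q) := fun k ↦ (hker_mem k).choose_spec
  have hψinj : Function.Injective ψ := by
    intro k k' h
    have h1 : ((ψ k : P₁) : Q₁) = ((ψ k' : P₁) : Q₁) := congrArg Subtype.val h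
    have h2 : ((k : P) : Q) = ((k' : P) : Q) := by rw [← hψι k, ← hψι k', h1]
    exact Subtype.ext (Subtype.ext h2)
  have hψsurj : Function.Surjective ψ := by
    intro c
    obtain ⟨x₁, hx₁⟩ := QuotientAddGroup.mk_surjective (c : Q₁)
    obtain ⟨n, hn⟩ := (hP₁ _).mp c.2
    have hmemP : (QuotientAddGroup.mk (j x₁) : Q) ∈ P := by
      refine (hP _).mpr ⟨n, ?_⟩
      rw [← hι, ← map_nsmul, hx₁, hn, map_zero]
    have hmemK : (⟨_, hmemP⟩ : P) ∈ φ.ker := by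
      rw [AddMonoidHom.mem_ker, hφ]
      change rbar (QuotientAddGroup.mk (j x₁)) = 0
      rw [hrbar, hjr]
    refine ⟨⟨_, hmemK⟩, Subtype.ext ?_⟩
    apply hιinj
    rw [hψι ⟨_, hmemK⟩, ← hx₁, hι]
  have hψadd : ∀ k k' : φ.ker, ψ (k + k') = ψ k + ψ k' := by
    intro k k'
    apply Subtype.ext
    apply hιinj
    have e1 : ι ((ψ (k + k') : P₁) : Q₁) = ((k + k' : φ.ker) : P) := hψι (k + k')
    have e2 : ι (((ψ k + ψ k' : P₁)) : Q₁) = ((k : P) : Q) + ((k' : P) : Q) := by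
      rw [AddSubgroup.coe_add, map_add, hψι, hψι]
    rw [e1, e2]
    rfl
  let eψ : φ.ker ≃+ P₁ :=
    { Equiv.ofBijective ψ ⟨hψinj, hψsurj⟩ with map_add' := hψadd }
  -- (2) the subgroup `A = ker φ ≤ P` and the injective quotient map `P/A ↪ r(M)[p^∞]`
  have hrange_le : ∀ c : P, ∃ hy : φ c ∈ r.range, (⟨φ c, hy⟩ : r.range) ∈ Ar := by
    intro c
    obtain ⟨x, hx⟩ := QuotientAddGroup.mk_surjective ((c : P) : Q)
    obtain ⟨n, hn⟩ := (hP _).mp (c : P).2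
    have hval : φ c = r x := by rw [hφ, ← hx, hrbar]
    refine ⟨⟨x, hval.symm⟩, (hAr _).mpr ⟨n, Subtype.ext ?_⟩⟩
    rw [AddSubmonoidClass.coe_nsmul, ZeroMemClass.coe_zero]
    change p ^ n • φ c = 0
    rw [← map_nsmul, hφ, AddSubmonoidClass.coe_nsmul, hn, map_zero]
  let g : P →+ Ar :=
    { toFun := fun c ↦ ⟨⟨φ c, (hrange_le c).1⟩, (hrange_le c).2⟩
      map_zero' := Subtype.ext (Subtype.ext (by simp))
      map_add' := fun a b ↦ Subtype.ext (Subtype.ext (by simp)) }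
  have hgval : ∀ c : P, (((g c : Ar) : r.range) : T) = φ c := fun _ ↦ rfl
  have hgker : g.ker = φ.ker := by
    ext c
    rw [AddMonoidHom.mem_ker, AddMonoidHom.mem_ker]
    constructor
    · intro h
      have h' := congrArg (fun z : Ar ↦ ((z : r.range) : T)) h
      simp only [hgval] at h'
      rw [h']; rfl
    · intro h
      exact Subtype.ext (Subtype.ext (by rw [hgval, h]; rfl))
  refine ⟨φ.ker, ⟨eψ⟩, ?_⟩
  -- `P/ker φ = P/ker g ↪ Ar`
  refine ⟨(QuotientAddGroup.kerLift g).comp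
    (QuotientAddGroup.quotientAddEquivOfEq hgker.symm).toAddMonoidHom, ?_⟩
  exact (QuotientAddGroup.kerLift_injective g).comp (QuotientAddGroup.quotientAddEquivOfEq hgker.symm).injective

end Summit.BirchSwinnertonDyer.BirchSwinnertonDyer.Theorems.InputsGreenbergLemma34Layer

end
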